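import Summits.RiemannHypothesis.RiemannHypothesis.Theorems.NymanBeurlingMinimiser
import HarnessLib

/-!
# RiemannHypothesis / Nyman–Beurling — residual orthogonality and (T4) `κ_N` TO ZEROTH ORDER (RH-FREE per N)

Column LI/NB of the RH ladder, rung L-P(P2) «structure of the NB minimiser», PROOF-OF-DATA for cell `pub/rh-li`
(theory memo `theory/TARGETS.md` §8.2 (T4), typed `NbKappaZerothOrder` in `theory/NBHeadTail.lean`).  DATUM: the certified
ratio `κ_N = tailConst(c⋆_N)/d_N² = 0.3403 … 0.3412` on `[2·10³, 10⁴]` (DATA.md §L, lineage R).  EXPLANATION to zeroth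
order: with `h = E[{1/x} | I_n]`, `Q = ‖{1/x} − h‖²`, `m_1 = 2 log 2 − 1` and `h₂ = h − m_1` on `(0,1]`,

* `integral_Ioi_approx_mul_nbRho`: for every `c`, `⟨χ − f_c, ρ_{k+1}⟩_{L²(0,∞)} = b_k − Σ_j c_j G_{kj}`; hence for the DATA
  object `c⋆_N = G⁻¹ b` the residual is ORTHOGONAL to every dilate and to every competitor `f_g`
  (`integral_Ioi_approx_nbMinimiser_mul_nbRho`, `integral_Ioi_approx_nbMinimiser_mul_sum`);
* `nbKappaZerothOrder_identity` (EXACT): `(1 + Q)·tailConst(c⋆_N) − m_1·d_N² = ∫_{(0,1]} (1 − f⋆) h₂` — i.e.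
  `κ_N = m_1/(1+Q) + ⟨χ − f⋆, h₂⟩_{(0,1]}/((1+Q) d_N²)`, zeroth order `m_1/(1+Q) = 0.3576` against the datum `0.341`;
* `nbKappaZerothOrder_full` (Cauchy–Schwarz form, any competitor `g`):
  `((1+Q)·tailConst(c⋆_N) − m_1·d_N²)² ≤ d_N² · (‖h₂ − f_g‖²_{L²(0,1]} + tailConst(g)²)` — the second factor is the FULL
  `L²(0,∞)` distance from `h₂` to the competitor (its `(1,∞)` tail is `tailConst(g)/x`).  NOTE for the theory seat: the
  typed `NbKappaZerothOrder` omits the `tailConst(g)²` term; that sharper form does not follow from Cauchy–Schwarz alone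
  (a float Farey-cell check at `N ≤ 6` finds it true with margin ×1.6–9, seat folder work/t4/t4check.py) and is NOT claimed here.

RH-FREE [rh-li-eng-3]: finite-`N` linear algebra and Lebesgue integrals on `(0,∞)`; nothing about `d_N → 0`; nothing here
bears on the truth of RH.
-/

noncomputable section

-- D-0017: `Summit.<S>.<S>.…` is the designed namespace of a single-problem summit.
set_option linter.dupNamespace false

open MeasureTheory Set Finset
open scoped Matrix

namespace Summit.RiemannHypothesis.RiemannHypothesis.Theorems.NbTheory

open Literature.NumberTheory.LFunctions Literature.NumberTheory.LFunctions.BaezDuarteOnlyIf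
open GramPosDef Minimiser

namespace KappaZeroth

/-! ## Integrability bookkeeping on `(0,∞)` -/

/-- `G` is symmetric entrywise. -/
lemma nbGram_comm (j k : ℕ) : nbGram j k = nbGram k j := by
  unfold nbGram; congr 1; funext x; ring

/-- `ρ_{j+1} ρ_{k+1}` is integrable on `(0,∞)`. -/
lemma integrableOn_nbRho_mul_nbRho_Ioi_zero (j k : ℕ) :
    IntegrableOn (fun x ↦ nbRho j x * nbRho k x) (Set.Ioi (0 : ℝ)) := by
  rw [← Set.Ioc_union_Ioi_eq_Ioi zero_le_one]
  exact (integrableOn_nbRho_mul_nbRho_Ioc j k).union (HeadTail.integrableOn_nbRho_mul_nbRho_Ioi j k)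

/-- `χ ρ_{k+1}` is integrable on `(0,∞)`. -/
lemma integrableOn_indicator_mul_nbRho (k : ℕ) :
    IntegrableOn (fun x ↦ (Set.Ioc (0 : ℝ) 1).indicator 1 x * nbRho k x) (Set.Ioi (0 : ℝ)) := by
  have h : (fun x ↦ (Set.Ioc (0 : ℝ) 1).indicator 1 x * nbRho k x) = (Set.Ioc (0 : ℝ) 1).indicator (nbRho k) := by
    funext x
    rw [← Set.indicator_mul_left (Set.Ioc (0 : ℝ) 1) 1 (nbRho k)]
    simp
  rw [h]
  exact ((integrableOn_nbRho k).integrable_indicator measurableSet_Ioc).integrableOn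

/-- `∫_{(0,∞)} χ ρ_{k+1} = b_k`. -/
lemma integral_Ioi_indicator_mul_nbRho (k : ℕ) :
    ∫ x in Set.Ioi (0 : ℝ), (Set.Ioc (0 : ℝ) 1).indicator 1 x * nbRho k x = nbRhs k := by
  have h : ∀ x, (Set.Ioc (0 : ℝ) 1).indicator 1 x * nbRho k x = (Set.Ioc (0 : ℝ) 1).indicator (nbRho k) x := by
    intro x
    rw [← Set.indicator_mul_left (Set.Ioc (0 : ℝ) 1) 1 (nbRho k)]
    simp
  simp_rw [h]
  rw [setIntegral_indicator measurableSet_Ioc, Set.inter_eq_self_of_subset_right Set.Ioc_subset_Ioi_self]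
  rfl

/-- On `x > 1` a competitor is `tailConst(g)/x`. -/
lemma sum_mul_nbRho_eq_of_one_lt {N : ℕ} (g : Fin N → ℝ) {x : ℝ} (hx : 1 < x) :
    ∑ k : Fin N, g k * nbRho k x = tailConst g * x⁻¹ := by
  rw [tailConst, Finset.sum_mul]
  refine Finset.sum_congr rfl fun k _ ↦ ?_
  rw [nbRho_eq_of_one_lt k hx]
  have hx0 : x ≠ 0 := by positivity
  field_simp

/-! ## A real Cauchy–Schwarz inequality for set integrals -/

/-- `(∫_s u v)² ≤ (∫_s u²)(∫_s v²)` for real functions with `u², v², uv` integrable on `s`. -/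
lemma sq_integral_mul_le {s : Set ℝ} {u v : ℝ → ℝ}
    (hu2 : IntegrableOn (fun x ↦ u x ^ 2) s) (hv2 : IntegrableOn (fun x ↦ v x ^ 2) s)
    (huv : IntegrableOn (fun x ↦ u x * v x) s) :
    (∫ x in s, u x * v x) ^ 2 ≤ (∫ x in s, u x ^ 2) * (∫ x in s, v x ^ 2) := by
  set A := ∫ x in s, v x ^ 2 with hA
  set B := ∫ x in s, u x * v x with hB
  set C := ∫ x in s, u x ^ 2 with hC
  have key : ∀ t : ℝ, 0 ≤ A * (t * t) + (-2 * B) * t + C := by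
    intro t
    have hnn : 0 ≤ ∫ x in s, (u x - t * v x) ^ 2 := integral_nonneg fun x ↦ sq_nonneg _
    have hexp : ∀ x, (u x - t * v x) ^ 2 = (u x ^ 2 - (2 * t) * (u x * v x)) + t ^ 2 * v x ^ 2 := fun x ↦ by ring
    have h1 : IntegrableOn (fun x ↦ u x ^ 2 - (2 * t) * (u x * v x)) s := hu2.sub (huv.const_mul _)
    have h2 : IntegrableOn (fun x ↦ t ^ 2 * v x ^ 2) s := hv2.const_mul _
    have hval : ∫ x in s, (u x - t * v x) ^ 2 = (C - 2 * t * B) + t ^ 2 * A := by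
      simp_rw [hexp]
      rw [integral_add h1 h2, integral_sub hu2 (huv.const_mul _), integral_const_mul, integral_const_mul]
    rw [hval] at hnn
    linarith
  have hd := discrim_le_zero key
  rw [discrim] at hd
  nlinarith

end KappaZeroth

open KappaZeroth

/-! ## Residual orthogonality -/

/-- **`⟨χ − f_c, ρ_{k+1}⟩_{L²(0,∞)} = b_k − Σ_j c_j G_{kj}` (RH-FREE)** — the gradient of the quadratic programme. -/
theorem integral_Ioi_approx_mul_nbRho {N : ℕ} (c : Fin N → ℝ) (k : ℕ) :
    ∫ x in Set.Ioi (0 : ℝ), approx c x * nbRho k x = nbRhs k - ∑ j : Fin N, c j * nbGram k j := by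
  have hpt : ∀ x, approx c x * nbRho k x =
      (Set.Ioc (0 : ℝ) 1).indicator 1 x * nbRho k x - ∑ j : Fin N, c j * (nbRho j x * nbRho k x) := by
    intro x
    show ((Set.Ioc (0 : ℝ) 1).indicator 1 x - ∑ j : Fin N, c j * nbRho j x) * nbRho k x = _
    rw [sub_mul, Finset.sum_mul]
    refine congrArg _ (Finset.sum_congr rfl fun j _ ↦ by ring)
  have hint : ∀ j : Fin N, IntegrableOn (fun x ↦ c j * (nbRho j x * nbRho k x)) (Set.Ioi (0 : ℝ)) :=
    fun j ↦ (integrableOn_nbRho_mul_nbRho_Ioi_zero j k).const_mul _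
  simp_rw [hpt]
  rw [integral_sub (integrableOn_indicator_mul_nbRho k) (integrable_finsetSum _ fun j _ ↦ hint j),
    integral_Ioi_indicator_mul_nbRho, integral_finsetSum _ fun j _ ↦ hint j]
  congr 1
  refine Finset.sum_congr rfl fun j _ ↦ ?_
  rw [integral_const_mul, nbGram_comm k j]
  rfl

/-- **The residual of the DATA object is orthogonal to every dilate:** `⟨χ − f⋆, ρ_{k+1}⟩_{L²(0,∞)} = 0`, `k < N`. -/
theorem integral_Ioi_approx_nbMinimiser_mul_nbRho {N : ℕ} (k : Fin N) :
    ∫ x in Set.Ioi (0 : ℝ), approx (nbMinimiser N) x * nbRho k x = 0 := by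
  rw [integral_Ioi_approx_mul_nbRho, ← nbMinimiser_normalEq N k]
  simp_rw [mul_comm (nbMinimiser N _) (nbGram _ _)]
  exact sub_self _

/-- … hence to every competitor `f_g = Σ g_k ρ_{k+1}`. -/
theorem integral_Ioi_approx_nbMinimiser_mul_sum {N : ℕ} (g : Fin N → ℝ) :
    ∫ x in Set.Ioi (0 : ℝ), approx (nbMinimiser N) x * ∑ k : Fin N, g k * nbRho k x = 0 := by
  have hint : ∀ k : Fin N,
      IntegrableOn (fun x ↦ g k * (approx (nbMinimiser N) x * nbRho k x)) (Set.Ioi (0 : ℝ)) := by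
    intro k
    refine Integrable.const_mul ?_ _
    have hpt : ∀ x, approx (nbMinimiser N) x * nbRho k x =
        (Set.Ioc (0 : ℝ) 1).indicator 1 x * nbRho k x -
          ∑ j : Fin N, nbMinimiser N j * (nbRho j x * nbRho k x) := by
      intro x
      show ((Set.Ioc (0 : ℝ) 1).indicator 1 x - ∑ j : Fin N, nbMinimiser N j * nbRho j x) * nbRho k x = _
      rw [sub_mul, Finset.sum_mul]
      refine congrArg _ (Finset.sum_congr rfl fun j _ ↦ by ring)
    simp_rw [hpt]
    exact (integrableOn_indicator_mul_nbRho k).sub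
      (integrable_finsetSum _ fun j _ ↦ (integrableOn_nbRho_mul_nbRho_Ioi_zero j k).const_mul _)
  have hpt : ∀ x, approx (nbMinimiser N) x * ∑ k : Fin N, g k * nbRho k x =
      ∑ k : Fin N, g k * (approx (nbMinimiser N) x * nbRho k x) := by
    intro x
    rw [Finset.mul_sum]
    exact Finset.sum_congr rfl fun k _ ↦ by ring
  simp_rw [hpt]
  rw [integral_finsetSum _ fun k _ ↦ hint k]
  refine Finset.sum_eq_zero fun k _ ↦ ?_
  rw [integral_const_mul, integral_Ioi_approx_nbMinimiser_mul_nbRho, mul_zero]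

/-! ## (T4) `κ_N` to zeroth order -/

/-- **(T4, EXACT FORM; RH-FREE per N).**  `(1 + Q)·tailConst(c⋆_N) − m_1·d_N² = ∫_{(0,1]} (1 − f⋆)·h₂`, where
`h₂ = h − m_1·𝟙_{(0,1]}`: the tail constant over `d_N²` is `m_1/(1+Q) = 0.3576` plus the `h₂`-correlation of the residual. -/
theorem nbKappaZerothOrder_identity {N : ℕ} (hN : 1 ≤ N) :
    (1 + nbQ) * tailConst (nbMinimiser N) - nbFareyMean 1 * nbDistSq N (nbMinimiser N) =
      ∫ x in Set.Ioc (0 : ℝ) 1, (1 - ∑ k : Fin N, nbMinimiser N k * nbRho k x) * nbStepH₂ x := by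
  set c := nbMinimiser N with hc
  rw [nbTailConstIdentity_nbMinimiser hN, nbDistSq_nbMinimiser, ← hc]
  have hγ : 1 - Real.eulerMascheroniConstant = ∫ x in Set.Ioc (0 : ℝ) 1, nbStepH x :=
    nbCondExpIntegral_holds.symm
  -- the integrand on `(0,1]`
  have hpt : ∀ x ∈ Set.Ioc (0 : ℝ) 1, (1 - ∑ k : Fin N, c k * nbRho k x) * nbStepH₂ x =
      (nbStepH x - ∑ k : Fin N, c k * (nbRho k x * nbStepH x)) -
        nbFareyMean 1 * (1 - ∑ k : Fin N, c k * nbRho k x) := by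
    intro x hx
    rw [nbStepH₂, Set.indicator_of_mem hx, Pi.one_apply, mul_one]
    have : ∑ k : Fin N, c k * (nbRho k x * nbStepH x) = (∑ k : Fin N, c k * nbRho k x) * nbStepH x := by
      rw [Finset.sum_mul]
      exact Finset.sum_congr rfl fun k _ ↦ by ring
    rw [this]
    ring
  have hf : IntegrableOn (fun x : ℝ ↦ ∑ k : Fin N, c k * nbRho k x) (Set.Ioc (0 : ℝ) 1) :=
    integrableOn_Ioc_of_bounded (measurable_sum_mul_nbRho c) (abs_sum_mul_nbRho_le c)
  have h1 : IntegrableOn (fun _ : ℝ ↦ (1 : ℝ)) (Set.Ioc (0 : ℝ) 1) :=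
    integrableOn_Ioc_of_bounded measurable_const (M := 1) fun _ ↦ by simp
  have hSk : ∀ k : Fin N, IntegrableOn (fun x ↦ c k * (nbRho k x * nbStepH x)) (Set.Ioc (0 : ℝ) 1) :=
    fun k ↦ (integrableOn_nbRho_mul_nbStepH (k : ℕ)).const_mul (c k)
  have hS : IntegrableOn (fun x ↦ ∑ k : Fin N, c k * (nbRho k x * nbStepH x)) (Set.Ioc (0 : ℝ) 1) :=
    integrable_finsetSum _ fun k _ ↦ hSk k
  have hA : IntegrableOn (fun x ↦ nbStepH x - ∑ k : Fin N, c k * (nbRho k x * nbStepH x)) (Set.Ioc (0 : ℝ) 1) :=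
    integrableOn_nbStepH.sub hS
  have hB : IntegrableOn (fun x ↦ nbFareyMean 1 * (1 - ∑ k : Fin N, c k * nbRho k x)) (Set.Ioc (0 : ℝ) 1) :=
    (h1.sub hf).const_mul _
  have hSval : ∫ x in Set.Ioc (0 : ℝ) 1, ∑ k : Fin N, c k * (nbRho k x * nbStepH x) =
      ∑ k : Fin N, c k * nbRhoH k := by
    rw [integral_finsetSum _ fun k _ ↦ hSk k]
    refine Finset.sum_congr rfl fun k _ ↦ ?_
    rw [integral_const_mul]
    rfl
  rw [setIntegral_congr_fun measurableSet_Ioc hpt, integral_sub hA hB, integral_const_mul,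
    integral_sub integrableOn_nbStepH hS, hSval,
    integral_sub h1 hf, integral_sum_mul_nbRho, setIntegral_const, smul_eq_mul, mul_one, measureReal_def,
    Real.volume_Ioc, ENNReal.toReal_ofReal (by norm_num : (0 : ℝ) ≤ 1 - 0), hγ, sub_zero]

/-- **(T4, CAUCHY–SCHWARZ FORM; RH-FREE per N).**  For the DATA object `c⋆_N` and ANY competitor `g`:
`((1+Q)·tailConst(c⋆_N) − m_1·d_N²)² ≤ d_N² · (∫_{(0,1]} (h₂ − f_g)² + tailConst(g)²)`
(the residual is orthogonal to `f_g` on `(0,∞)`, and `‖h₂ − f_g‖²_{L²(0,∞)}` has the `(1,∞)` tail `tailConst(g)²`). -/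
theorem nbKappaZerothOrder_full {N : ℕ} (hN : 1 ≤ N) (g : Fin N → ℝ) :
    ((1 + nbQ) * tailConst (nbMinimiser N) - nbFareyMean 1 * nbDistSq N (nbMinimiser N)) ^ 2 ≤
      nbDistSq N (nbMinimiser N) *
        ((∫ x in Set.Ioc (0 : ℝ) 1, (nbStepH₂ x - ∑ k : Fin N, g k * nbRho k x) ^ 2) + tailConst g ^ 2) := by
  set c := nbMinimiser N with hc
  -- the comparison function `W = h₂ − f_g` on `(0,∞)` (`= −f_g = approx g` on `(1,∞)`)
  set W : ℝ → ℝ := fun x ↦ nbStepH₂ x - ∑ k : Fin N, g k * nbRho k x with hW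
  have hW1 : ∀ x ∈ Set.Ioi (1 : ℝ), W x = approx g x := by
    intro x hx
    have hx' : x ∉ Set.Ioc (0 : ℝ) 1 := fun h ↦ absurd h.2 (not_le.2 hx)
    have hh : nbStepH x = 0 := by
      unfold nbStepH; rw [if_neg]; push Not; intro; exact hx
    simp only [hW, nbStepH₂, hh, Set.indicator_of_notMem hx', mul_zero, sub_zero, zero_sub,
      approx_eq_of_one_lt g hx, sum_mul_nbRho_eq_of_one_lt g hx, neg_mul]
  -- Step 1: the left side is `∫_{(0,∞)} approx c⋆ · W`
  have hWm : Measurable W := by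
    have h2 : Measurable nbStepH₂ :=
      measurable_nbStepH.sub (measurable_const.mul (measurable_const.indicator measurableSet_Ioc))
    exact h2.sub (measurable_sum_mul_nbRho g)
  have hWb : ∀ x, |nbStepH₂ x| ≤ 2 := by
    intro x
    unfold nbStepH₂
    have h1 := abs_nbStepH_le x
    have hm0 := nbFareyMean_nonneg 1
    have hm1 := nbFareyMean_le_one 1
    by_cases hx : x ∈ Set.Ioc (0 : ℝ) 1
    · rw [Set.indicator_of_mem hx, Pi.one_apply, mul_one]
      calc |nbStepH x - nbFareyMean 1| ≤ |nbStepH x| + |nbFareyMean 1| := abs_sub _ _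
        _ ≤ 1 + 1 := add_le_add h1 (by rw [abs_of_nonneg hm0]; exact hm1)
        _ = 2 := by norm_num
    · rw [Set.indicator_of_notMem hx, mul_zero, sub_zero]; linarith
  have hcW_Ioc : IntegrableOn (fun x ↦ approx c x * W x) (Set.Ioc (0 : ℝ) 1) := by
    refine integrableOn_Ioc_of_bounded ((measurable_approx c).mul hWm)
      (M := coeffBound c * (2 + ∑ k : Fin N, |g k|)) fun x ↦ ?_
    rw [abs_mul]
    have ha := abs_approx_le c x
    have hw : |W x| ≤ 2 + ∑ k : Fin N, |g k| := by
      calc |W x| ≤ |nbStepH₂ x| + |∑ k : Fin N, g k * nbRho k x| := abs_sub _ _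
        _ ≤ 2 + ∑ k : Fin N, |g k| := add_le_add (hWb x) (abs_sum_mul_nbRho_le g x)
    exact mul_le_mul ha hw (abs_nonneg _) (le_trans (abs_nonneg _) ha)
  have hcW_Ioi : IntegrableOn (fun x ↦ approx c x * W x) (Set.Ioi (1 : ℝ)) := by
    have h := (integrableOn_sq_approx c).mono_set (Set.Ioi_subset_Ioi zero_le_one)
    have h' : IntegrableOn (fun x ↦ approx c x * approx g x) (Set.Ioi (1 : ℝ)) := by
      have hh : IntegrableOn (fun x : ℝ ↦ (tailConst c * tailConst g) * x ^ (-2 : ℝ)) (Set.Ioi (1 : ℝ)) :=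
        (integrableOn_Ioi_rpow_of_lt (by norm_num : (-2 : ℝ) < -1) zero_lt_one).const_mul _
      refine hh.congr_fun (fun x hx ↦ ?_) measurableSet_Ioi
      have hx0 : 0 < x := zero_lt_one.trans hx
      beta_reduce
      rw [approx_eq_of_one_lt c hx, approx_eq_of_one_lt g hx, Real.rpow_neg hx0.le, Real.rpow_two]
      field_simp
    exact h'.congr_fun (fun x hx ↦ by rw [hW1 x hx]) measurableSet_Ioi
  have hcW : IntegrableOn (fun x ↦ approx c x * W x) (Set.Ioi (0 : ℝ)) := by
    rw [← Set.Ioc_union_Ioi_eq_Ioi zero_le_one]; exact hcW_Ioc.union hcW_Ioi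
  have hX : (1 + nbQ) * tailConst c - nbFareyMean 1 * nbDistSq N c = ∫ x in Set.Ioi (0 : ℝ), approx c x * W x := by
    rw [hc, nbKappaZerothOrder_identity hN, ← hc]
    -- `∫_{(0,∞)} approx c · W = ∫_{(0,1]} (1 − f⋆) h₂ − ∫_{(0,1]} (1 − f⋆) f_g + ∫_{(1,∞)} approx c · approx g`
    -- and `∫_{(0,∞)} approx c · f_g = 0`; assemble via the split `(0,∞) = (0,1] ∪ (1,∞)`.
    have horth := integral_Ioi_approx_nbMinimiser_mul_sum (N := N) g
    rw [← hc] at horth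
    have hsplitW : ∫ x in Set.Ioi (0 : ℝ), approx c x * W x =
        (∫ x in Set.Ioc (0 : ℝ) 1, approx c x * W x) + ∫ x in Set.Ioi (1 : ℝ), approx c x * W x := by
      rw [← Set.Ioc_union_Ioi_eq_Ioi zero_le_one,
        setIntegral_union Set.Ioc_disjoint_Ioi_same measurableSet_Ioi hcW_Ioc hcW_Ioi]
    -- the `f_g`-part, split the same way
    have hcF_Ioc : IntegrableOn (fun x ↦ approx c x * ∑ k : Fin N, g k * nbRho k x) (Set.Ioc (0 : ℝ) 1) := by
      refine integrableOn_Ioc_of_bounded ((measurable_approx c).mul (measurable_sum_mul_nbRho g))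
        (M := coeffBound c * ∑ k : Fin N, |g k|) fun x ↦ ?_
      rw [abs_mul]
      have ha := abs_approx_le c x
      exact mul_le_mul ha (abs_sum_mul_nbRho_le g x) (abs_nonneg _) (le_trans (abs_nonneg _) ha)
    have hcF_Ioi : IntegrableOn (fun x ↦ approx c x * ∑ k : Fin N, g k * nbRho k x) (Set.Ioi (1 : ℝ)) := by
      have hh : IntegrableOn (fun x : ℝ ↦ (-(tailConst c * tailConst g)) * x ^ (-2 : ℝ)) (Set.Ioi (1 : ℝ)) :=
        (integrableOn_Ioi_rpow_of_lt (by norm_num : (-2 : ℝ) < -1) zero_lt_one).const_mul _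
      refine hh.congr_fun (fun x hx ↦ ?_) measurableSet_Ioi
      have hx0 : 0 < x := zero_lt_one.trans hx
      beta_reduce
      rw [approx_eq_of_one_lt c hx, sum_mul_nbRho_eq_of_one_lt g hx, Real.rpow_neg hx0.le, Real.rpow_two]
      field_simp
    have hsplitF : ∫ x in Set.Ioi (0 : ℝ), approx c x * ∑ k : Fin N, g k * nbRho k x =
        (∫ x in Set.Ioc (0 : ℝ) 1, approx c x * ∑ k : Fin N, g k * nbRho k x) +
          ∫ x in Set.Ioi (1 : ℝ), approx c x * ∑ k : Fin N, g k * nbRho k x := by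
      rw [← Set.Ioc_union_Ioi_eq_Ioi zero_le_one,
        setIntegral_union Set.Ioc_disjoint_Ioi_same measurableSet_Ioi hcF_Ioc hcF_Ioi]
    -- on `(1,∞)`: `approx c · W = −(approx c · f_g)`
    have hIoi : ∫ x in Set.Ioi (1 : ℝ), approx c x * W x =
        -∫ x in Set.Ioi (1 : ℝ), approx c x * ∑ k : Fin N, g k * nbRho k x := by
      rw [← integral_neg]
      refine setIntegral_congr_fun measurableSet_Ioi fun x hx ↦ ?_
      have hx' : x ∉ Set.Ioc (0 : ℝ) 1 := fun h ↦ absurd h.2 (not_le.2 hx)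
      have hh : nbStepH x = 0 := by
        unfold nbStepH; rw [if_neg]; push Not; intro; exact hx
      simp only [hW, nbStepH₂, hh, Set.indicator_of_notMem hx', mul_zero, sub_zero, zero_sub, mul_neg]
    -- on `(0,1]`: `approx c · W = (1 − f⋆) h₂ − approx c · f_g`
    have hP : IntegrableOn (fun x ↦ (1 - ∑ k : Fin N, c k * nbRho k x) * nbStepH₂ x) (Set.Ioc (0 : ℝ) 1) :=
      (hcW_Ioc.add hcF_Ioc).congr_fun (fun x hx ↦ by
        simp only [hW, Pi.add_apply]
        rw [approx_eq_of_mem_Ioc c hx]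
        ring) measurableSet_Ioc
    have hIoc : ∫ x in Set.Ioc (0 : ℝ) 1, approx c x * W x =
        (∫ x in Set.Ioc (0 : ℝ) 1, (1 - ∑ k : Fin N, c k * nbRho k x) * nbStepH₂ x) -
          ∫ x in Set.Ioc (0 : ℝ) 1, approx c x * ∑ k : Fin N, g k * nbRho k x := by
      rw [← integral_sub hP hcF_Ioc]
      refine setIntegral_congr_fun measurableSet_Ioc fun x hx ↦ ?_
      simp only [hW]
      rw [approx_eq_of_mem_Ioc c hx]
      ring
    rw [hsplitW, hIoi, hIoc]
    rw [hsplitF] at horth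
    linarith
  -- Step 2: Cauchy–Schwarz on `(0,∞)` and the value of `∫ W²`
  have hW2_Ioc : IntegrableOn (fun x ↦ W x ^ 2) (Set.Ioc (0 : ℝ) 1) := by
    refine integrableOn_Ioc_of_bounded (hWm.pow_const 2) (M := (2 + ∑ k : Fin N, |g k|) ^ 2) fun x ↦ ?_
    have hw : |W x| ≤ 2 + ∑ k : Fin N, |g k| := by
      calc |W x| ≤ |nbStepH₂ x| + |∑ k : Fin N, g k * nbRho k x| := abs_sub _ _
        _ ≤ 2 + ∑ k : Fin N, |g k| := add_le_add (hWb x) (abs_sum_mul_nbRho_le g x)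
    rw [abs_pow]
    exact pow_le_pow_left₀ (abs_nonneg _) hw 2
  have hW2_Ioi : IntegrableOn (fun x ↦ W x ^ 2) (Set.Ioi (1 : ℝ)) :=
    ((integrableOn_sq_approx g).mono_set (Set.Ioi_subset_Ioi zero_le_one)).congr_fun
      (fun x hx ↦ by rw [hW1 x hx]) measurableSet_Ioi
  have hW2 : IntegrableOn (fun x ↦ W x ^ 2) (Set.Ioi (0 : ℝ)) := by
    rw [← Set.Ioc_union_Ioi_eq_Ioi zero_le_one]; exact hW2_Ioc.union hW2_Ioi
  have hW2val : ∫ x in Set.Ioi (0 : ℝ), W x ^ 2 =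
      (∫ x in Set.Ioc (0 : ℝ) 1, (nbStepH₂ x - ∑ k : Fin N, g k * nbRho k x) ^ 2) + tailConst g ^ 2 := by
    rw [← Set.Ioc_union_Ioi_eq_Ioi zero_le_one,
      setIntegral_union Set.Ioc_disjoint_Ioi_same measurableSet_Ioi hW2_Ioc hW2_Ioi,
      ← integral_Ioi_one_sq_approx g, setIntegral_congr_fun measurableSet_Ioi fun x hx ↦ by rw [hW1 x hx]]
  have hCS := sq_integral_mul_le (integrableOn_sq_approx c) hW2 hcW
  rw [← hX, ← nbDistSq_eq_integral, hW2val] at hCS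
  exact hCS

end Summit.RiemannHypothesis.RiemannHypothesis.Theorems.NbTheory

end
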